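/-
Copyright (c) 2026 the pub-hodgecm-mathlib formalisation cell (harness21).  Prover seat hodgecm-mathlib-F0P3-p01 (g34), Track A «(D-RAM) FOUR-FRAME», unit U2H, the (ρ2b′-X)
census road — socket (B) lead LH4-p07 (g7) 2026-09-04T07:21:22Z «p01: r1»: the TYPE-FREE cut-off organ `hRcells` of ★ p858032, both frames, for the (A) and (B) heads.
-/
import Summits.HodgeConjecture.HodgeConjecture.Theorems.F0P3cDyRamConeTubeBound                    -- ★ p858039 (LH4-p05): GAP-R `le_of_levelSetDep_nonempty`; brings ★ (β) ED. 2 `exists_flipUnit_of_forall_fixed_fixed_isNorm`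
import Summits.HodgeConjecture.HodgeConjecture.Theorems.F0P3cDyRamFixedPointCensusTypeTwoPrelude     -- ★ p857439 (LH4-p14): `setOf_typeZero_fixed_eq_setOf_isSelfDualLattice_block`, `antidiagonal_three_over_eq_block_antidiagonal_two`; brings :418's tokens
import Literature.NumberTheory.Automorphic.UnitaryGroupFormTransport                               -- ★ `conj_mem_unitaryGroupOfForm_iff` (`PgP⁻¹ ∈ U(H) ↔ g ∈ U(ᵗσP H P)`)
import Literature.NumberTheory.Rogawski1990.UnitaryVertexStabilizerCoverCM                         -- ★ `galAdicCompletionMap_involutive`, `placeForm_map_transpose_of_hermitian`, `isUnit_det_placeForm`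
import Literature.NumberTheory.Automorphic.LocalUnitaryGroupCongr                                  -- ★ `antidiagOne_isHermitian`, `isUnit_antidiagOne_det`
import HarnessLib

/-!
# Crux `H413`, line LH4 «(D-RAM) FOUR-FRAME» — leaf (ρ2b′-X), the ORDER-COUNT CENSUS bottoms (A)∕(B): THE CELL CUT-OFF `hRcells` AT THE CM PLACE, BOTH FRAMES

Cell `hodgecm-mathlib` (D-0151), FLOOR 0, crux item H413 = `stmt-HodgeConjecture-24833`, route of record `HCCMUnconditional`; squad F0∕P3c∕LH4, unit U2H, leaf (ρ2b′-X)
`stub_U2H_fixedPointCensus_typeTwo_unit0` (U2H ED. 15 :418) through the payer lineage's order-count sockets (A) `orderCountCensusA` (LH4-p11 (g5)) and (B)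
`orderCountCensusB` (LH4-p07 (g7), Compose.B.v5 seams (S-R)∕(S-R′)).  THEOREMS ONLY (no `def`, no instance, no notation, no named fact, no `sorry`, default heartbeats);
lane `--supports stmt-HodgeConjecture-24833 --as helper` (count-neutral).  No `tE`-value, no `d`-value, no class letter: TYPE-FREE.

WHAT IS PROVED.  The toric re-indexing ★ p858032 `F0P3cDyRamToricLevelCensusUnr.orderCounts_eq_censusSum_unr_of_cells` consumes, for each of the two line models `(φ, h)`
(hyperbolic literal `ι_w(t_h) = endoGL (γ₂, u)`, plane `(Φ₂)_w`) and `(φ′, h′)` (anisotropic literal `ι_w(t_a) = P₁·endoGL (γ₁, u)·P₁⁻¹`, plane `Matrix.diagonal dg`, frame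
equation `formCongr σ_w P₁ (Φ₃)_w = block(diag dg, η)`), the CELL CUT-OFF
  `hRcells : ∀ j b, 1 ≤ b → lam ∈ 𝒪_j → levelSetDep(j, b; lam − jE u₀₀) ≠ ∅ → b ≤ R`.
This file derives it, ONCE for both heads, from the socket letters of record (`SOCKET-hOCA.v1` ∕ `SOCKET-hOCB.v1`, LH4-p14 (g4)) — the two literals `hth`∕`hta`, the frame
equation `hform`, `hdg1 hdgσ hησ hη1`, the line models, `hjpow`, `hsmall`, the socket cut-offs `hRV` (vertex-lattice currency) ∕ `hRS` (self-dual block currency) — plus the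
norm clause `hFN : ∀ f, ρ f = f → Θ f = f → |f| = 1 → ∃ z, z·Θz = f` AS A HYPOTHESIS (bottom (A) feeds ★ p857997 `forall_fixed_fixed_isNorm_of_typeU`, bottom (B) feeds ★
p858020 `forall_fixed_fixed_exists_mul_theta_eq_of_frame`), the line-model field `(M, jE, ρ, Θ, α)` ABSTRACT:
* `hRcells_h` — frame `h`: flip unit ★ (β) ED. 2 `exists_flipUnit_of_forall_fixed_fixed_isNorm` ∘ ★ GAP-R `le_of_levelSetDep_nonempty` at `(H₂, h_W) := ((Φ₂)_w, 1)`, the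
  unitarity `hΓ` read off `hth` and `Φ₃ = block(Φ₂, 1)` (★ Prelude `antidiagonal_three_over_eq_block_antidiagonal_two`), the cut-off `hRV` transported to the self-dual block
  currency by ★ Prelude `setOf_typeZero_fixed_eq_setOf_isSelfDualLattice_block` (template ★ p857748 §1);
* `hRcells_h'` — frame `h′`: the same at `(H₂, h_W) := (Matrix.diagonal dg, η)`, the unitarity `hΓ′` read off `hta` and the frame equation through ★
  `conj_mem_unitaryGroupOfForm_iff` (template ★ p857748 §2), the cut-off `hRS` verbatim.
HONEST LABEL: HC_CM is proved only modulo the 7 printed citations (2 remaining named inputs: hLiu418 = stmt-HodgeConjecture-24832, h413 = stmt-HodgeConjecture-24833) until rung 0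
closes; (ρ2b′-X) stays an OPEN prover target; helper (`--supports`), proofs only, pure composition of ★ organs; nothing printed is asserted.

## References
* [Kottwitz1986BaseChangeUnits] R. E. Kottwitz, *Base change for unit elements of Hecke algebras*, Compositio Math. 60 (1986), §1 pp. 240–241 (fixed self-dual lattices of a
  unitary element), §3 pp. 247–249 (Levi blocks).
* [Rogawski1990] J. D. Rogawski, *Automorphic Representations of Unitary Groups in Three Variables*, Ann. of Math. Stud. 123 (1990), §4.3 p. 43; §4.9 Prop. 4.9.1 (b) p. 55, Lemma 4.9.3 p. 56.
* [BruhatTits1972] F. Bruhat, J. Tits, *Groupes réductifs sur un corps local I*, Publ. Math. IHÉS 41 (1972), §10 (tube layers of the rank-one building).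
* [Jacobowitz1962] R. Jacobowitz, *Hermitian forms over local fields*, Amer. J. Math. 84 (1962), §4 (dual lattices, gluing).
-/

set_option autoImplicit false

noncomputable section

namespace Summit.HodgeConjecture.HodgeConjecture.Cruxes.H413.F0P3cDyRamOrderCountCellsBound

-- THE LINES MODULE'S `open` CONTEXT (tree `Cruxes/H413/Lines/F0_P3c_DyRamFourFrame_U2H_HSide.lean`, after its `namespace`), as in ★ p857748 ∕ Compose.B.v5:
open MeasureTheory Measure NumberField IsDedekindDomain Topology Filter
open Literature.NumberTheory.Automorphic Literature.NumberTheory.Automorphic.UnitaryGroup Literature.NumberTheory.Automorphic.IntegralReduction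
open Literature.NumberTheory.Rogawski1990 Literature.NumberTheory.GaloisRepresentations
open Literature.NumberTheory.Automorphic.UnitaryThreeFourFrame
open scoped Matrix MatrixGroups Classical Valued WithZero
open Literature.NumberTheory.Automorphic.UnitaryLatticeTree Literature.NumberTheory.Automorphic.HermitianLattice
open Literature.NumberTheory.Automorphic.EllipticPlaneAsFieldLine
open Literature.NumberTheory.LocalFields.QuadraticOrder
open Summit.HodgeConjecture.HodgeConjecture.Cruxes.H413.F0P3cDyRamToricCensusDefs
open Summit.HodgeConjecture.HodgeConjecture.Cruxes.H413.F0P3cDyRamConeWeightHalfSplit (exists_flipUnit_of_forall_fixed_fixed_isNorm)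
open Summit.HodgeConjecture.HodgeConjecture.Cruxes.H413.F0P3cDyRamConeTubeBound (le_of_levelSetDep_nonempty)
open Summit.HodgeConjecture.HodgeConjecture.Cruxes.H413.F0P3cDyRamFixedPointCensusTypeTwoPrelude

/-! ## §1 Frame `h` — the hyperbolic literal `ι_w(t_h) = endoGL (γ₂, u)` for `Φ₃ = block(Φ₂, 1)`; cut-off `hRV` in the vertex-lattice currency -/

/-- **`hRcells` FOR THE FRAME `h` (hyperbolic literal) AT THE CM PLACE — type-free.**  Under the order-count socket's letters (datum `hD`, `|2|_w < 1`, the line model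
`(M, jE, ρ, Θ, α; φ, lam, h)` of the plane `((Φ₂)_w, γ₂)`, `hjv`, `hjpow`, `hϖmax`, the literal `hth : ι_w(t_h) = endoGL (γ₂, u)`, `|u₀₀| = 1`, the vertex-lattice cut-off `hRV`)
and the norm clause `hFN` as a hypothesis: **every non-empty cone cell `levelSetDep(j, b; lam − jE u₀₀)` with `b ≥ 1`, `lam ∈ 𝒪_j` has `b ≤ R`** — the `hRcells` binder of ★
p858032 `orderCounts_eq_censusSum_unr_of_cells`.  ★ (β) ED. 2 flip unit ∘ ★ GAP-R `le_of_levelSetDep_nonempty` at `((Φ₂)_w, 1)`, `hΓ` from `hth` and `Φ₃ = block(Φ₂, 1)`, `hRV`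
transported by ★ Prelude `setOf_typeZero_fixed_eq_setOf_isSelfDualLattice_block`.
[cite: Kottwitz1986BaseChangeUnits, §1 pp. 240–241] [cite: Rogawski1990, §4.3 p. 43; §4.9 Prop. 4.9.1 (b) p. 55] [cite: BruhatTits1972, §10] [cite: Jacobowitz1962, §4] -/
theorem hRcells_h (L : Type) [Field L] [NumberField L] [IsCMField L]
    {v : HeightOneSpectrum (𝓞 ↥(maximalRealSubfield L))} (w : UnitaryGroup.PlacesOver L v)
    (hw : IsCMField.complexConj L • w.1 = w.1) {ϖ : (w.1.adicCompletion L)} (hϖ : Valued.v ϖ = WithZero.exp (-1 : ℤ)) {d tE : ℕ}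
    (hD : IsRamifiedQuadraticDatum (galAdicCompletionMap (L := L) (IsCMField.complexConj L) hw) ϖ d tE)
    (h2v : Valued.v (2 : (w.1.adicCompletion L)) < 1)
    [Fintype (Valued.ResidueField (w.1.adicCompletion L))]
    {M : Type*} [Field M] [Valued M ℤᵐ⁰] {ρ Θ : M →+* M} {α : M} (jE : (w.1.adicCompletion L) →+* M)
    (hρρ : ∀ x, ρ (ρ x) = x) (hvρ : ∀ x, Valued.v (ρ x) = Valued.v x)
    (hjv : ∀ c, Valued.v (jE c) ≤ 1 ↔ Valued.v c ≤ 1) (hjfix : ∀ z, ρ z = z ↔ ∃ c, jE c = z)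
    (hΘj : ∀ x, Θ (jE x) = jE ((galAdicCompletionMap (L := L) (IsCMField.complexConj L) hw) x))
    (hΘΘ : ∀ x, Θ (Θ x) = x) (hΘρ : ∀ x, Θ (ρ x) = ρ (Θ x)) (hvΘ : ∀ x, Valued.v (Θ x) = Valued.v x)
    (hα : ρ α ≠ α) (hα1 : Valued.v α ≤ 1) (hint : ∀ z : M, Valued.v z ≤ 1 → Valued.v ((z - ρ z) / (α - ρ α)) ≤ 1)
    {lam : M} (hlam : Valued.v lam = 1)
    -- the hyperbolic literal `ι_w(t_h) = endoGL (γ₂, u)`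
    {th : ((UnitaryGroup.cmDatum L 3 (Matrix.of fun i j : Fin 3 => if i.val + j.val + 1 = 3 then (1 : L) else 0)).Local v)}
    {γ₂ : GL (Fin 2) (w.1.adicCompletion L)} {u : GL (Fin 1) (w.1.adicCompletion L)}
    (hth : ((localNonsplitEquiv (IsCMField.complexConj L) (Matrix.of fun i j : Fin 3 => if i.val + j.val + 1 = 3 then (1 : L) else 0) (IsCMField.complexConj_ne_one L) w hw th :
        ↥(unitaryGroupOfForm (galAdicCompletionMap (L := L) (IsCMField.complexConj L) hw) (placeForm (Matrix.of fun i j : Fin 3 => if i.val + j.val + 1 = 3 then (1 : L) else 0) w.1))) :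
        GL (Fin 3) (w.1.adicCompletion L)) = endoGL (γ₂, u))
    -- the line model `(φ, h)` of the plane `((Φ₂)_w, γ₂)`
    (φ : (Fin 2 → (w.1.adicCompletion L)) →+ M) {h : M}
    (hφs : ∀ (c : (w.1.adicCompletion L)) (x : Fin 2 → (w.1.adicCompletion L)), φ (c • x) = jE c * φ x)
    (hφi : Function.Injective φ) (hφo : Function.Surjective φ)
    (hφγ : ∀ x, φ ((γ₂ : Matrix (Fin 2) (Fin 2) (w.1.adicCompletion L)).mulVec x) = lam * φ x)
    (hform : ∀ x y, jE (pairing (galAdicCompletionMap (L := L) (IsCMField.complexConj L) hw) (placeForm (Matrix.of fun i j : Fin 2 => if i.val + j.val + 1 = 2 then (1 : L) else 0) w.1) x y) =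
      h * Θ (φ x) * φ y + ρ (h * Θ (φ x) * φ y))
    (hΘh : Θ h = h) (hh : h ≠ 0)
    (hjpow : ∀ (t : (w.1.adicCompletion L)) (n : ℤ), Valued.v (jE t) = Valued.v (jE ϖ) ^ n ↔ Valued.v t = Valued.v ϖ ^ n)
    (hϖmax : ∀ t : M, ρ t = t → Valued.v t < 1 → Valued.v t ≤ Valued.v (jE ϖ))
    -- the socket cut-off, vertex-lattice currency
    {R : ℕ}
    (hRV : ∀ M₃ : Submodule (Valued.integer (w.1.adicCompletion L)) (Fin 3 → (w.1.adicCompletion L)),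
      IsVertexLattice (galAdicCompletionMap (L := L) (IsCMField.complexConj L) hw) ϖ ((StdForm.antidiagonal 3).over (w.1.adicCompletion L)) 0 M₃ →
      mapGL (endoGL (γ₂, u)) M₃ = M₃ → ∀ b : ℕ, (∀ c : (w.1.adicCompletion L), (Pi.single 1 c : Fin 3 → (w.1.adicCompletion L)) ∈ M₃ ↔ Valued.v c ≤ Valued.v ϖ ^ b) → b ≤ R)
    (hu : Valued.v ((u : Matrix (Fin 1) (Fin 1) (w.1.adicCompletion L)) 0 0) = 1)
    -- the norm clause of the socket's conclusion, as a hypothesis (★ p857997 on type U, ★ p858020 on type RamK)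
    (hFN : ∀ f : M, ρ f = f → Θ f = f → Valued.v f = 1 → ∃ z : M, z * Θ z = f) :
    ∀ j b : ℕ, 1 ≤ b → IsOrd ρ α (jE ϖ ^ j) lam →
      (levelSetDep ρ Θ α (jE ϖ) h j b (lam - jE ((u : Matrix (Fin 1) (Fin 1) (w.1.adicCompletion L)) 0 0))).Nonempty → b ≤ R := by
  intro j b hb hlamj hne
  haveI : IsDiscreteValuationRing 𝒪[w.1.adicCompletion L] := inferInstanceAs (IsDiscreteValuationRing (w.1.adicCompletionIntegers L))
  haveI : Finite 𝓀[w.1.adicCompletion L] := Finite.of_fintype (Valued.ResidueField (w.1.adicCompletion L))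
  have hσ : ∀ a, (galAdicCompletionMap (L := L) (IsCMField.complexConj L) hw) ((galAdicCompletionMap (L := L) (IsCMField.complexConj L) hw) a) = a :=
    galAdicCompletionMap_involutive L v w hw
  have hvσ : ∀ a, Valued.v ((galAdicCompletionMap (L := L) (IsCMField.complexConj L) hw) a) = Valued.v a :=
    fun a => valued_galAdicCompletionMap (L := L) (IsCMField.complexConj L) hw a
  -- `(Φ₂)_w` is hermitian of unit determinant
  have hH₂ : IsUnit (placeForm (Matrix.of fun i j : Fin 2 => if i.val + j.val + 1 = 2 then (1 : L) else 0) w.1).det :=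
    isUnit_det_placeForm L v w _ (isUnit_antidiagOne_det L 2).ne_zero
  have hH₂σ : ((placeForm (Matrix.of fun i j : Fin 2 => if i.val + j.val + 1 = 2 then (1 : L) else 0) w.1).map (galAdicCompletionMap (L := L) (IsCMField.complexConj L) hw))ᵀ =
      placeForm (Matrix.of fun i j : Fin 2 => if i.val + j.val + 1 = 2 then (1 : L) else 0) w.1 :=
    placeForm_map_transpose_of_hermitian L v w hw _ (antidiagOne_isHermitian L 2)
  -- `Φ₃ = block(Φ₂, 1)` on the nose
  have hblock : placeForm (Matrix.of fun i j : Fin 3 => if i.val + j.val + 1 = 3 then (1 : L) else 0) w.1 =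
      (!![(placeForm (Matrix.of fun i j : Fin 2 => if i.val + j.val + 1 = 2 then (1 : L) else 0) w.1) 0 0, 0,
          (placeForm (Matrix.of fun i j : Fin 2 => if i.val + j.val + 1 = 2 then (1 : L) else 0) w.1) 0 1;
         0, (1 : w.1.adicCompletion L), 0;
         (placeForm (Matrix.of fun i j : Fin 2 => if i.val + j.val + 1 = 2 then (1 : L) else 0) w.1) 1 0, 0,
          (placeForm (Matrix.of fun i j : Fin 2 => if i.val + j.val + 1 = 2 then (1 : L) else 0) w.1) 1 1] : Matrix (Fin 3) (Fin 3) (w.1.adicCompletion L)) := by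
    rw [placeForm_antidiagOne, placeForm_antidiagOne, antidiagonal_three_over_eq_block_antidiagonal_two]
  -- the block element is unitary: it IS `ι_w(t_h)`
  have hΓ : endoGL (γ₂, u) ∈ unitaryGroupOfForm (galAdicCompletionMap (L := L) (IsCMField.complexConj L) hw)
      (!![(placeForm (Matrix.of fun i j : Fin 2 => if i.val + j.val + 1 = 2 then (1 : L) else 0) w.1) 0 0, 0,
          (placeForm (Matrix.of fun i j : Fin 2 => if i.val + j.val + 1 = 2 then (1 : L) else 0) w.1) 0 1;
         0, (1 : w.1.adicCompletion L), 0;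
         (placeForm (Matrix.of fun i j : Fin 2 => if i.val + j.val + 1 = 2 then (1 : L) else 0) w.1) 1 0, 0,
          (placeForm (Matrix.of fun i j : Fin 2 => if i.val + j.val + 1 = 2 then (1 : L) else 0) w.1) 1 1] : Matrix (Fin 3) (Fin 3) (w.1.adicCompletion L)) := by
    rw [← hblock, ← hth]
    exact (localNonsplitEquiv (IsCMField.complexConj L) (Matrix.of fun i j : Fin 3 => if i.val + j.val + 1 = 3 then (1 : L) else 0)
      (IsCMField.complexConj_ne_one L) w hw th).2
  -- the cut-off in the self-dual block currency
  have hR' : ∀ M₃ : Submodule (Valued.integer (w.1.adicCompletion L)) (Fin 3 → (w.1.adicCompletion L)),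
      IsSelfDualLattice (galAdicCompletionMap (L := L) (IsCMField.complexConj L) hw) ϖ
        (!![(placeForm (Matrix.of fun i j : Fin 2 => if i.val + j.val + 1 = 2 then (1 : L) else 0) w.1) 0 0, 0,
            (placeForm (Matrix.of fun i j : Fin 2 => if i.val + j.val + 1 = 2 then (1 : L) else 0) w.1) 0 1;
           0, (1 : w.1.adicCompletion L), 0;
           (placeForm (Matrix.of fun i j : Fin 2 => if i.val + j.val + 1 = 2 then (1 : L) else 0) w.1) 1 0, 0,
            (placeForm (Matrix.of fun i j : Fin 2 => if i.val + j.val + 1 = 2 then (1 : L) else 0) w.1) 1 1] : Matrix (Fin 3) (Fin 3) (w.1.adicCompletion L)) M₃ →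
      mapGL (endoGL (γ₂, u)) M₃ = M₃ → ∀ b : ℕ, (∀ c : (w.1.adicCompletion L), (Pi.single 1 c : Fin 3 → (w.1.adicCompletion L)) ∈ M₃ ↔ Valued.v c ≤ Valued.v ϖ ^ b) → b ≤ R := by
    intro M₃ hM₃ hfix b' hb'
    have hmem : M₃ ∈ {M₃ : Submodule (Valued.integer (w.1.adicCompletion L)) (Fin 3 → (w.1.adicCompletion L)) |
        IsSelfDualLattice (galAdicCompletionMap (L := L) (IsCMField.complexConj L) hw) ϖ
          (!![(placeForm (Matrix.of fun i j : Fin 2 => if i.val + j.val + 1 = 2 then (1 : L) else 0) w.1) 0 0, 0,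
              (placeForm (Matrix.of fun i j : Fin 2 => if i.val + j.val + 1 = 2 then (1 : L) else 0) w.1) 0 1;
             0, (1 : w.1.adicCompletion L), 0;
             (placeForm (Matrix.of fun i j : Fin 2 => if i.val + j.val + 1 = 2 then (1 : L) else 0) w.1) 1 0, 0,
              (placeForm (Matrix.of fun i j : Fin 2 => if i.val + j.val + 1 = 2 then (1 : L) else 0) w.1) 1 1] : Matrix (Fin 3) (Fin 3) (w.1.adicCompletion L)) M₃ ∧
        mapGL (endoGL (γ₂, u)) M₃ = M₃} := ⟨hM₃, hfix⟩
    rw [← setOf_typeZero_fixed_eq_setOf_isSelfDualLattice_block L w hw ϖ] at hmem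
    exact hRV M₃ hmem.1 hmem.2 b' hb'
  -- the flip unit (★ (β) ED. 2) and GAP-R (★ p858039)
  obtain ⟨z, ξ, hz1, hzξ, hσξ, hξN⟩ :=
    exists_flipUnit_of_forall_fixed_fixed_isNorm (galAdicCompletionMap (L := L) (IsCMField.complexConj L) hw) hD jE hvΘ hΘj hjfix hjpow hFN
  exact le_of_levelSetDep_nonempty (galAdicCompletionMap (L := L) (IsCMField.complexConj L) hw) hσ hvσ hϖ hD h2v hH₂ hH₂σ
    (hW := (1 : w.1.adicCompletion L)) (by rw [map_one]) (map_one _) jE hρρ hvρ hα hα1 hint hΘΘ hΘρ hvΘ hΘj hjv hjfix hjpow hϖmax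
    φ hφs hφi hφo hφγ hlam hΘh hh hform z hz1 ξ hzξ hσξ hξN u hΓ hu hR' hb hlamj hne

/-! ## §2 Frame `h′` — the anisotropic literal `ι_w(t_a) = P₁·endoGL (γ₁, u)·P₁⁻¹` with `ᵗσ(P₁) Φ₃ P₁ = block(diag dg, η)`; cut-off `hRS` in the block currency -/

/-- **`hRcells` FOR THE FRAME `h′` (anisotropic literal) AT THE CM PLACE — type-free.**  Under the order-count socket's letters (datum `hD`, `|2|_w < 1`, the line model
`(M, jE, ρ, Θ, α; φ′, lam, h′)` of the plane `(Matrix.diagonal dg, γ₁)`, `hjv`, `hjpow`, `hϖmax`, the literal `hta : ι_w(t_a) = P₁·endoGL (γ₁, u)·P₁⁻¹` with the frame equation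
`hform : formCongr σ_w P₁ (Φ₃)_w = block(diag dg, η)`, `|dg i| = 1`, `σ_w dg = dg`, `σ_w η = η`, `|η| = 1`, `|u₀₀| = 1`, the block cut-off `hRS`) and the norm clause `hFN` as a
hypothesis: **every non-empty cone cell `levelSetDep(j, b; lam − jE u₀₀)` of the frame `h′` with `b ≥ 1`, `lam ∈ 𝒪_j` has `b ≤ R′`** — the `hRcells` binder of ★ p858032 for the
second order count.  ★ (β) ED. 2 flip unit ∘ ★ GAP-R at `(Matrix.diagonal dg, η)`, `hΓ′` from `hta` and the frame equation through ★ `conj_mem_unitaryGroupOfForm_iff`.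
[cite: Kottwitz1986BaseChangeUnits, §1 pp. 240–241] [cite: Rogawski1990, §4.9 Lemma 4.9.3 p. 56] [cite: BruhatTits1972, §10] [cite: Jacobowitz1962, §4] -/
theorem hRcells_h' (L : Type) [Field L] [NumberField L] [IsCMField L]
    {v : HeightOneSpectrum (𝓞 ↥(maximalRealSubfield L))} (w : UnitaryGroup.PlacesOver L v)
    (hw : IsCMField.complexConj L • w.1 = w.1) {ϖ : (w.1.adicCompletion L)} (hϖ : Valued.v ϖ = WithZero.exp (-1 : ℤ)) {d tE : ℕ}
    (hD : IsRamifiedQuadraticDatum (galAdicCompletionMap (L := L) (IsCMField.complexConj L) hw) ϖ d tE)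
    (h2v : Valued.v (2 : (w.1.adicCompletion L)) < 1)
    [Fintype (Valued.ResidueField (w.1.adicCompletion L))]
    {M : Type*} [Field M] [Valued M ℤᵐ⁰] {ρ Θ : M →+* M} {α : M} (jE : (w.1.adicCompletion L) →+* M)
    (hρρ : ∀ x, ρ (ρ x) = x) (hvρ : ∀ x, Valued.v (ρ x) = Valued.v x)
    (hjv : ∀ c, Valued.v (jE c) ≤ 1 ↔ Valued.v c ≤ 1) (hjfix : ∀ z, ρ z = z ↔ ∃ c, jE c = z)
    (hΘj : ∀ x, Θ (jE x) = jE ((galAdicCompletionMap (L := L) (IsCMField.complexConj L) hw) x))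
    (hΘΘ : ∀ x, Θ (Θ x) = x) (hΘρ : ∀ x, Θ (ρ x) = ρ (Θ x)) (hvΘ : ∀ x, Valued.v (Θ x) = Valued.v x)
    (hα : ρ α ≠ α) (hα1 : Valued.v α ≤ 1) (hint : ∀ z : M, Valued.v z ≤ 1 → Valued.v ((z - ρ z) / (α - ρ α)) ≤ 1)
    {lam : M} (hlam : Valued.v lam = 1)
    -- the anisotropic literal `ι_w(t_a) = P₁·endoGL (γ₁, u)·P₁⁻¹` and its frame equation
    {ta : ((UnitaryGroup.cmDatum L 3 (Matrix.of fun i j : Fin 3 => if i.val + j.val + 1 = 3 then (1 : L) else 0)).Local v)}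
    {P₁ : GL (Fin 3) (w.1.adicCompletion L)} {dg : Fin 2 → (w.1.adicCompletion L)} {η : (w.1.adicCompletion L)}
    {γ₁ : GL (Fin 2) (w.1.adicCompletion L)} {u : GL (Fin 1) (w.1.adicCompletion L)}
    (hta : ((localNonsplitEquiv (IsCMField.complexConj L) (Matrix.of fun i j : Fin 3 => if i.val + j.val + 1 = 3 then (1 : L) else 0) (IsCMField.complexConj_ne_one L) w hw ta :
        ↥(unitaryGroupOfForm (galAdicCompletionMap (L := L) (IsCMField.complexConj L) hw) (placeForm (Matrix.of fun i j : Fin 3 => if i.val + j.val + 1 = 3 then (1 : L) else 0) w.1))) :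
        GL (Fin 3) (w.1.adicCompletion L)) = P₁ * endoGL (γ₁, u) * P₁⁻¹)
    (hform : formCongr (galAdicCompletionMap (L := L) (IsCMField.complexConj L) hw) P₁ (placeForm (Matrix.of fun i j : Fin 3 => if i.val + j.val + 1 = 3 then (1 : L) else 0) w.1) =
      (!![(Matrix.diagonal dg) 0 0, 0, (Matrix.diagonal dg) 0 1; 0, η, 0; (Matrix.diagonal dg) 1 0, 0, (Matrix.diagonal dg) 1 1] : Matrix (Fin 3) (Fin 3) (w.1.adicCompletion L)))
    (hdg1 : ∀ i, Valued.v (dg i) = 1) (hdgσ : ∀ i, (galAdicCompletionMap (L := L) (IsCMField.complexConj L) hw) (dg i) = dg i)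
    (hησ : (galAdicCompletionMap (L := L) (IsCMField.complexConj L) hw) η = η) (hη1 : Valued.v η = 1)
    -- the line model `(φ′, h′)` of the plane `(Matrix.diagonal dg, γ₁)`
    (φ' : (Fin 2 → (w.1.adicCompletion L)) →+ M) {h' : M}
    (hφ's : ∀ (c : (w.1.adicCompletion L)) (x : Fin 2 → (w.1.adicCompletion L)), φ' (c • x) = jE c * φ' x)
    (hφ'i : Function.Injective φ') (hφ'o : Function.Surjective φ')
    (hφ'γ : ∀ x, φ' ((γ₁ : Matrix (Fin 2) (Fin 2) (w.1.adicCompletion L)).mulVec x) = lam * φ' x)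
    (hform' : ∀ x y, jE (pairing (galAdicCompletionMap (L := L) (IsCMField.complexConj L) hw) (Matrix.diagonal dg) x y) = h' * Θ (φ' x) * φ' y + ρ (h' * Θ (φ' x) * φ' y))
    (hΘh' : Θ h' = h') (hh' : h' ≠ 0)
    (hjpow : ∀ (t : (w.1.adicCompletion L)) (n : ℤ), Valued.v (jE t) = Valued.v (jE ϖ) ^ n ↔ Valued.v t = Valued.v ϖ ^ n)
    (hϖmax : ∀ t : M, ρ t = t → Valued.v t < 1 → Valued.v t ≤ Valued.v (jE ϖ))
    -- the socket cut-off, self-dual block currency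
    {R' : ℕ}
    (hRS : ∀ M₃ : Submodule (Valued.integer (w.1.adicCompletion L)) (Fin 3 → (w.1.adicCompletion L)),
      IsSelfDualLattice (galAdicCompletionMap (L := L) (IsCMField.complexConj L) hw) ϖ
        (!![(Matrix.diagonal dg) 0 0, 0, (Matrix.diagonal dg) 0 1; 0, η, 0; (Matrix.diagonal dg) 1 0, 0, (Matrix.diagonal dg) 1 1] : Matrix (Fin 3) (Fin 3) (w.1.adicCompletion L)) M₃ →
      mapGL (endoGL (γ₁, u)) M₃ = M₃ → ∀ b : ℕ, (∀ c : (w.1.adicCompletion L), (Pi.single 1 c : Fin 3 → (w.1.adicCompletion L)) ∈ M₃ ↔ Valued.v c ≤ Valued.v ϖ ^ b) → b ≤ R')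
    (hu : Valued.v ((u : Matrix (Fin 1) (Fin 1) (w.1.adicCompletion L)) 0 0) = 1)
    -- the norm clause of the socket's conclusion, as a hypothesis
    (hFN : ∀ f : M, ρ f = f → Θ f = f → Valued.v f = 1 → ∃ z : M, z * Θ z = f) :
    ∀ j b : ℕ, 1 ≤ b → IsOrd ρ α (jE ϖ ^ j) lam →
      (levelSetDep ρ Θ α (jE ϖ) h' j b (lam - jE ((u : Matrix (Fin 1) (Fin 1) (w.1.adicCompletion L)) 0 0))).Nonempty → b ≤ R' := by
  intro j b hb hlamj hne
  haveI : IsDiscreteValuationRing 𝒪[w.1.adicCompletion L] := inferInstanceAs (IsDiscreteValuationRing (w.1.adicCompletionIntegers L))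
  haveI : Finite 𝓀[w.1.adicCompletion L] := Finite.of_fintype (Valued.ResidueField (w.1.adicCompletion L))
  have hσ : ∀ a, (galAdicCompletionMap (L := L) (IsCMField.complexConj L) hw) ((galAdicCompletionMap (L := L) (IsCMField.complexConj L) hw) a) = a :=
    galAdicCompletionMap_involutive L v w hw
  have hvσ : ∀ a, Valued.v ((galAdicCompletionMap (L := L) (IsCMField.complexConj L) hw) a) = Valued.v a :=
    fun a => valued_galAdicCompletionMap (L := L) (IsCMField.complexConj L) hw a
  -- `diag dg` is hermitian of unit determinant
  have hH₂ : IsUnit (Matrix.diagonal dg).det := by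
    rw [Matrix.det_diagonal]
    refine isUnit_iff_ne_zero.2 (Finset.prod_ne_zero_iff.2 fun i _ h0 => ?_)
    have h1 := hdg1 i
    rw [h0, map_zero] at h1
    exact zero_ne_one h1
  have hH₂σ : ((Matrix.diagonal dg).map (galAdicCompletionMap (L := L) (IsCMField.complexConj L) hw))ᵀ = Matrix.diagonal dg := by
    rw [Matrix.diagonal_map (map_zero _), Matrix.diagonal_transpose]
    exact congrArg Matrix.diagonal (funext hdgσ)
  -- `ι_w(t_a)` is unitary for `(Φ₃)_w`, hence the block element is unitary for the congruent form
  have hmem : P₁ * endoGL (γ₁, u) * P₁⁻¹ ∈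
      unitaryGroupOfForm (galAdicCompletionMap (L := L) (IsCMField.complexConj L) hw) (placeForm (Matrix.of fun i j : Fin 3 => if i.val + j.val + 1 = 3 then (1 : L) else 0) w.1) := by
    rw [← hta]
    exact (localNonsplitEquiv (IsCMField.complexConj L) (Matrix.of fun i j : Fin 3 => if i.val + j.val + 1 = 3 then (1 : L) else 0)
      (IsCMField.complexConj_ne_one L) w hw ta).2
  have hΓ : endoGL (γ₁, u) ∈ unitaryGroupOfForm (galAdicCompletionMap (L := L) (IsCMField.complexConj L) hw)
      (!![(Matrix.diagonal dg) 0 0, 0, (Matrix.diagonal dg) 0 1; 0, η, 0; (Matrix.diagonal dg) 1 0, 0, (Matrix.diagonal dg) 1 1] : Matrix (Fin 3) (Fin 3) (w.1.adicCompletion L)) := by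
    rw [← hform]
    exact (conj_mem_unitaryGroupOfForm_iff (galAdicCompletionMap (L := L) (IsCMField.complexConj L) hw) P₁ _ (endoGL (γ₁, u))).1 hmem
  -- the flip unit (★ (β) ED. 2) and GAP-R (★ p858039)
  obtain ⟨z, ξ, hz1, hzξ, hσξ, hξN⟩ :=
    exists_flipUnit_of_forall_fixed_fixed_isNorm (galAdicCompletionMap (L := L) (IsCMField.complexConj L) hw) hD jE hvΘ hΘj hjfix hjpow hFN
  exact le_of_levelSetDep_nonempty (galAdicCompletionMap (L := L) (IsCMField.complexConj L) hw) hσ hvσ hϖ hD h2v hH₂ hH₂σ hη1 hησ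
    jE hρρ hvρ hα hα1 hint hΘΘ hΘρ hvΘ hΘj hjv hjfix hjpow hϖmax
    φ' hφ's hφ'i hφ'o hφ'γ hlam hΘh' hh' hform' z hz1 ξ hzξ hσξ hξN u hΓ hu hRS hb hlamj hne

end Summit.HodgeConjecture.HodgeConjecture.Cruxes.H413.F0P3cDyRamOrderCountCellsBound

end
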